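import Literature.Analysis.FluidPDE.JetStepArithmetic
import Literature.Barriers.NavierStokesRegularity.BuckmasterVicolNonuniquenessIteration
import Literature.Barriers.AnomalousDissipation.ConvexIntegrationNonLerayStart
import HarnessLib

/-!
# Buckmaster–Vicol 2019, Thm. 1.3 — the iteration from level `n` (Prop. 2.1 + §2.4), proved;
  `BuckmasterVicol2019_thm13_holds`

Sibling proof file of the barrier entry
`Literature/Barriers/AnomalousDissipation/ConvexIntegrationNonLeray` (D-0021), closing the
`provefact` programme for `BuckmasterVicol2019_thm13` (Buckmaster–Vicol, Ann. of Math. 189 (2019),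
Thm. 1.3): the named fact `BuckmasterVicol2019_iterationFromLevel` of
`ConvexIntegrationNonLerayProofs` (Prop. 2.1 of the paper iterated from level `n`, with the limit
argument of §2.4, exactly as invoked in §2.5) is PROVED here, by an intermittent convex-integration
scheme formalised in the `Analysis/FluidPDE/Jet*` files: the jet-based form of the scheme of the
Buckmaster–Vicol survey (EMS Surv. Math. Sci. 6 (2019), §7: space–time mollification of the
Navier–Stokes–Reynolds triple, intermittent jets, the perturbation `w = w^{(p)} + w^{(c)} + w^{(t)}`
with its temporal corrector, the new stress through the inverse divergence) in place of the
intermittent Beltrami flows of the Annals paper — the two schemes prove the same Prop. 2.1; the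
survey's is the simpler bookkeeping. The step with all parameters symbolic is
`JetStep.jet_step` (`FluidPDE/JetStepTheorem`), the choice of the parameters as powers of
`λ_{q+1}` and the verification of the inductive estimates (2.3)–(2.5), (2.8) is
`JetStep.StepPars.step_arith` (`FluidPDE/JetStepArithmetic`); this file runs the induction on the
level (`jstage_step`, stages `JStage`) and the `C⁰_t L²`/`C⁰_t H^{β'}` limit of §2.4 (the argument
of the proved `BuckmasterVicol2019_thm12_of_prop21` of
`Barriers/NavierStokesRegularity/BuckmasterVicolNonuniquenessIteration`, without energy profile),
and assembles `BuckmasterVicol2019_thm13_holds` from the proved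
`BuckmasterVicol2019_thm13_of_parts` and `BuckmasterVicol2019_mollifiedEulerStart_holds`.

Parameters (for the record): `b ≥ b₀ = 20000`, `16 ∣ b`, `βb ≤ 1/40`; `ε_R ≤ ε₀ = 1/200`;
`N_Λ = 1`; at level `q ≥ 1` with `L = λ_{q+1} = λ_q^b`: `σ = L^{3/16} ∈ ℕ`, `κ = r_∥⁻¹ = L^{1/2}`,
`μ = r_⊥⁻¹ = L^{13/16}`, `μ′ = L^{5/4}`, `ℓ = L^{-1/16}`, floor `γ₀ = δ_{q+1}`; the new `L¹` stress is
`≤ L^{-11/200} ≤ λ_{q+1}^{-ε_R} δ_{q+2}` since `2βb ≤ 1/20`.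

## References

* T. Buckmaster, V. Vicol, *Nonuniqueness of weak solutions to the Navier–Stokes equation*,
  Ann. of Math. 189 (2019), 101–144 = arXiv:1709.10033: Prop. 2.1, §2.4, §2.5, Thm. 1.3.
  [`BuckmasterVicol2019Annals`]
* T. Buckmaster, V. Vicol, *Convex integration and phenomenologies in turbulence*, EMS Surv.
  Math. Sci. 6 (2019), 173–263 = arXiv:1901.09023: §7 (Prop. 7.2 and its proof), Thm. 3.10.
  [`BuckmasterVicol2020`]
-/

noncomputable section

open MeasureTheory Set Filter Function
open scoped ENNReal NNReal InnerProductSpace Topology ContDiff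

namespace Literature.Barriers.AnomalousDissipation

open Literature.Analysis.FunctionSpaces Literature.Analysis.FluidPDE
open Literature.Barriers.NavierStokesRegularity
open Literature.Barriers.AnomalousDissipation.BV2019
open Literature.Analysis.FluidPDE.JetStep

/-- The flat three-torus `T³ = (ℝ/ℤ)³` (local notation). -/
local notation "𝕋³" => UnitAddTorus (Fin 3)
/-- Velocity values (local notation). -/
local notation "ℝ³" => EuclideanSpace ℝ (Fin 3)

/-! ## Parameter lemmas -/

section Parameters

/-- `λ_{q+1} = λ_q^b` over `ℝ` (from `BV2019.freq_succ`). [folklore] -/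
theorem freq_succ_real (a b q : ℕ) : (freq a b (q + 1) : ℝ) = (freq a b q : ℝ) ^ b := by
  exact_mod_cast freq_succ a b q

/-- `a ≤ λ_q` for `a ≥ 1`… in fact for all `a` (`b^q ≥ 1` when `b ≥ 1`). [folklore] -/
theorem le_freq {a b : ℕ} (hb : 1 ≤ b) (q : ℕ) : a ≤ freq a b q := by
  rw [freq]
  rcases Nat.eq_zero_or_pos a with rfl | ha
  · simp
  · calc a = a ^ 1 := (pow_one a).symm
      _ ≤ a ^ b ^ q := Nat.pow_le_pow_right ha (Nat.one_le_pow _ _ hb)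

/-- `δ_{q+1} ≤ 1` for `q ≥ 1`, `b ≥ 2`, `a ≥ 1`, `β ≥ 0`. [folklore] -/
theorem amp_succ_le_one {a b : ℕ} (ha : 1 ≤ a) (hb : 2 ≤ b) {β : ℝ} (hβ : 0 ≤ β) {q : ℕ} (hq : 1 ≤ q) :
    amp β a b (q + 1) ≤ 1 := by
  have h1 : (0 : ℝ) < (freq a b 1 : ℝ) := freq_real_pos ha b 1
  have hq' : (0 : ℝ) < (freq a b (q + 1) : ℝ) := freq_real_pos ha b (q + 1)
  -- `λ_1^3 ≤ λ_{q+1}^2`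
  have hnat : freq a b 1 ^ 3 ≤ freq a b (q + 1) ^ 2 := by
    rw [freq, freq, ← pow_mul, ← pow_mul, pow_one]
    refine Nat.pow_le_pow_right ha ?_
    have h2 : b ^ 2 ≤ b ^ (q + 1) := Nat.pow_le_pow_right (by omega) (by omega)
    nlinarith
  have hreal : ((freq a b 1 : ℝ)) ^ (3 : ℝ) ≤ ((freq a b (q + 1) : ℝ)) ^ (2 : ℝ) := by
    rw [show (3 : ℝ) = ((3 : ℕ) : ℝ) by norm_num, show (2 : ℝ) = ((2 : ℕ) : ℝ) by norm_num,
      Real.rpow_natCast, Real.rpow_natCast]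
    exact_mod_cast hnat
  rw [amp, show (3 : ℝ) * β = 3 * β by rfl, show 3 * β = (3 : ℝ) * β by rfl, Real.rpow_mul h1.le,
    show -2 * β = (2 : ℝ) * (-β) by ring, Real.rpow_mul hq'.le]
  have hA : 0 < (freq a b (q + 1) : ℝ) ^ (2 : ℝ) := Real.rpow_pos_of_pos hq' _
  rw [Real.rpow_neg hA.le, ← div_eq_mul_inv, div_le_one (Real.rpow_pos_of_pos hA β)]
  exact Real.rpow_le_rpow (Real.rpow_nonneg h1.le _) hreal hβ

/-- `δ_{q+1} ≥ λ_{q+1}^{-2β}`. [folklore] -/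
theorem rpow_le_amp {a : ℕ} (ha : 1 ≤ a) (b : ℕ) {β : ℝ} (hβ : 0 ≤ β) (q : ℕ) :
    (freq a b q : ℝ) ^ (-(2 * β)) ≤ amp β a b q := by
  rw [amp, show -2 * β = -(2 * β) by ring]
  refine le_mul_of_one_le_left (Real.rpow_nonneg (Nat.cast_nonneg _) _) ?_
  exact Real.one_le_rpow (one_le_freq_real ha b 1) (by positivity)

end Parameters

/-! ## The stages of the iteration (no energy profile) -/

/-- A **stage at level `q`** of the iteration of §2.5: a classical Navier–Stokes–Reynolds triple on
`[0,T] × T³` with zero-mean velocity obeying (2.3) `‖v‖_{C¹_{x,t}} ≤ λ_q⁴`, (2.4)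
`‖R̊‖_{L¹} ≤ λ_q^{-ε_R} δ_{q+1}` and the sup part `‖R̊‖_{C⁰} ≤ λ_q^{10}` of (2.5) (the scheme
mollifies the stress, so no derivative of `R̊_q` is ever used). [cite: BuckmasterVicol2019Annals, §2.2 (2.3)–(2.5)] -/
structure JStage (ν T εR β : ℝ) (a b q : ℕ) where
  /-- The velocity `v_q`. -/
  v : ℝ → 𝕋³ → ℝ³
  /-- The pressure `p_q`. -/
  p : ℝ → 𝕋³ → ℝ
  /-- The Reynolds stress `R̊_q` (by columns). -/
  R : ℝ → 𝕋³ → Fin 3 → ℝ³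
  /-- The Navier–Stokes–Reynolds system on `[0,T] × T³`. -/
  nsr : Torus.IsNSReynoldsOn (Icc 0 T) ν v p R
  /-- Zero spatial mean of the velocity. -/
  mean : ∀ t ∈ Icc 0 T, Torus.HasZeroMean (v t)
  /-- (2.3). -/
  c1v : C1xtLE T v ((freq a b q : ℝ) ^ 4)
  /-- (2.4). -/
  l1R : L1LE T R ((freq a b q : ℝ) ^ (-εR) * amp β a b (q + 1))
  /-- The sup part of (2.5). -/
  supR : ∀ t ∈ Icc 0 T, ∀ x, ‖R t x‖ ≤ (freq a b q : ℝ) ^ 10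

namespace JStage

variable {ν T εR β : ℝ} {a b n : ℕ}

/-- Running the iteration from level `n`. [folklore] -/
def iterate (S₀ : JStage ν T εR β a b n)
    (step : ∀ k, JStage ν T εR β a b (n + k) → JStage ν T εR β a b (n + k + 1)) :
    ∀ k, JStage ν T εR β a b (n + k)
  | 0 => S₀
  | k + 1 => step k (iterate S₀ step k)

end JStage

/-- All three sup norms of a `C¹_{x,t}`-bounded field are below the bound. [folklore] -/
theorem c1xtLE_sup_bounds {F : Type*} [NormedAddCommGroup F] [NormedSpace ℝ F] {T : ℝ} {f : ℝ → 𝕋³ → F}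
    {B : ℝ} (h : C1xtLE T f B) (hT : 0 ≤ T) :
    (∀ t ∈ Icc 0 T, ∀ x, ‖f t x‖ ≤ B) ∧ (∀ i, ∀ t ∈ Icc 0 T, ∀ x, ‖Torus.partialDeriv i (f t) x‖ ≤ B) ∧
      (∀ t ∈ Icc 0 T, ∀ x, ‖Torus.timeDerivWithin (Icc 0 T) f t x‖ ≤ B) := by
  obtain ⟨B₀, B₂, B₁, h0, h1, h2, hs⟩ := h
  have hmem : (0 : ℝ) ∈ Icc 0 T := ⟨le_rfl, hT⟩
  have hB₀ : 0 ≤ B₀ := (norm_nonneg _).trans (h0 0 hmem 0)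
  have hB₁ : ∀ i, 0 ≤ B₁ i := fun i => (norm_nonneg _).trans (h1 i 0 hmem 0)
  have hB₂ : 0 ≤ B₂ := (norm_nonneg _).trans (h2 0 hmem 0)
  have hsum : 0 ≤ ∑ i, B₁ i := Finset.sum_nonneg fun i _ => hB₁ i
  have hi : ∀ i, B₁ i ≤ ∑ j, B₁ j := fun i => Finset.single_le_sum (fun j _ => hB₁ j) (Finset.mem_univ i)
  refine ⟨fun t ht x => (h0 t ht x).trans (by linarith), fun i t ht x => (h1 i t ht x).trans ?_,
    fun t ht x => (h2 t ht x).trans (by linarith)⟩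
  linarith [hi i]

/-! ## One step of the iteration: `JetStep.jet_step` in the regime of `JetStep.step_arith` -/

/-- **The step `q ↦ q+1` of the Buckmaster–Vicol iteration, proved** (Prop. 2.1 without energy
profile, for `q ≥ 1`, in the jet scheme): for `b ≥ 20000` with `16 ∣ b`, `βb ≤ 1/40`,
`ε_R ≤ 1/200` and `T > 0` there are an absolute `M` and a threshold `a₀` such that for
`a ≥ a₀`, `ν ∈ (0,1]` and `q ≥ 1` every stage at level `q` has a successor at level `q+1` with
`‖v_{q+1}(t) - v_q(t)‖_{L²} ≤ M δ_{q+1}^{1/2}` (2.8). [cite: BuckmasterVicol2019Annals, Prop. 2.1; BuckmasterVicol2020, Prop. 7.2] -/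
theorem jstage_step {b : ℕ} (hb : 20000 ≤ b) (hb16 : 16 ∣ b) {β : ℝ} (hβ : 0 < β) (hβb : β * b ≤ 1 / 40)
    {εR : ℝ} (hεR : 0 < εR) (hεR0 : εR ≤ 1 / 200) :
    ∃ M : ℝ, 0 < M ∧ ∀ {T : ℝ}, 0 < T → ∃ a₀ : ℕ, ∀ {a : ℕ}, a₀ ≤ a → ∀ {ν : ℝ}, 0 < ν → ν ≤ 1 →
    ∀ q : ℕ, 1 ≤ q → ∀ S : JStage ν T εR β a b q, ∃ S' : JStage ν T εR β a b (q + 1),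
      ∀ t ∈ Icc 0 T, eLpNorm (S'.v t - S.v t) 2 volume ≤ ENNReal.ofReal (M * amp β a b (q + 1) ^ (1 / 2 : ℝ)) := by
  obtain ⟨c, hc, hstep⟩ := JetStep.jet_step
  obtain ⟨M, hM, harith⟩ := JetStep.StepPars.step_arith hc
  refine ⟨M, hM, fun {T} hT => ?_⟩
  obtain ⟨L₀, hL₀, hL₀P⟩ := harith T
  obtain ⟨L₁, hL₁, hL₁P⟩ := JetStep.StepPars.exists_threshold_valid hT
  refine ⟨max (Nat.ceil (max L₀ L₁)) 2, fun {a} ha {ν} hν hν1 q hq S => ?_⟩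
  -- numerology of `a, b`
  have ha2 : 2 ≤ a := le_trans (le_max_right _ _) ha
  have ha1 : 1 ≤ a := le_trans one_le_two ha2
  have haR : max L₀ L₁ ≤ (a : ℝ) := (Nat.le_ceil _).trans (by exact_mod_cast le_trans (le_max_left _ _) ha)
  have hb1 : 1 ≤ b := by omega
  have hbR : (20000 : ℝ) ≤ b := by exact_mod_cast hb
  set lam : ℝ := (freq a b q : ℝ) with hlam
  set L : ℝ := (freq a b (q + 1) : ℝ) with hLdef
  have hlam1 : 1 ≤ lam := one_le_freq_real ha1 b q
  have hL1 : 1 ≤ L := one_le_freq_real ha1 b (q + 1)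
  have hL0 : 0 < L := by linarith
  have hlam0 : 0 ≤ lam := by linarith
  have hLlam : L = lam ^ b := freq_succ_real a b q
  have haL : (a : ℝ) ≤ L := by rw [hLdef]; exact_mod_cast le_freq (a := a) hb1 (q + 1)
  have hL₀L : L₀ ≤ L := le_trans (le_max_left _ _) (haR.trans haL)
  have hL₁L : L₁ ≤ L := le_trans (le_max_right _ _) (haR.trans haL)
  obtain ⟨hℓ4, hℓT, hμ60, hκ1, hmup0⟩ := hL₁P L hL₁L
  -- `σ = L^{3/16} ∈ ℕ`
  obtain ⟨m, hm⟩ : 16 ∣ b ^ (q + 1) := Dvd.dvd.pow hb16 (Nat.succ_ne_zero q)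
  have hLa : L = (a : ℝ) ^ (16 * m) := by rw [hLdef, freq, hm]; push_cast; rfl
  have hσeq : ((a ^ (3 * m) : ℕ) : ℝ) = L ^ (3 / 16 : ℝ) := by
    rw [hLa, ← Real.rpow_natCast (a : ℝ) (16 * m), ← Real.rpow_mul (Nat.cast_nonneg a)]
    push_cast
    rw [show (16 : ℝ) * m * (3 / 16) = ((3 * m : ℕ) : ℝ) by push_cast; ring, Real.rpow_natCast]
  have hσpos : 0 < a ^ (3 * m) := pow_pos (by omega) _
  -- the parameters of the step
  set γ₀ : ℝ := amp β a b (q + 1) with hγ₀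
  have hγ₀0 : 0 < γ₀ := amp_pos β ha1 b (q + 1)
  have hγ₀1 : γ₀ ≤ 1 := amp_succ_le_one ha1 (by omega) hβ.le hq
  set P : JetStep.StepPars := ⟨T, lam ^ 4, lam ^ 10, lam ^ (-εR) * γ₀, γ₀, L ^ (-(1 / 16 : ℝ)), a ^ (3 * m),
    L ^ (1 / 2 : ℝ), L ^ (13 / 16 : ℝ), L ^ (5 / 4 : ℝ)⟩ with hPdef
  have hPV : P.Valid := by
    refine ⟨hT, one_le_pow₀ hlam1, one_le_pow₀ hlam1, mul_pos (Real.rpow_pos_of_pos (by linarith) _) hγ₀0, hγ₀0,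
      Real.rpow_pos_of_pos hL0 _, hℓ4, hℓT, hσpos, hκ1, hμ60, hmup0⟩
  have hβsmall : 2 * β ≤ 1 / (20 * B0) := by
    rw [JetStep.B0]
    have hb0 : (0 : ℝ) < b := by linarith
    have : β ≤ 1 / (40 * b) := by rw [le_div_iff₀ (by positivity)]; nlinarith
    calc 2 * β ≤ 2 * (1 / (40 * b)) := by linarith
      _ ≤ 1 / (20 * 20000) := by
          rw [show 2 * (1 / (40 * (b : ℝ))) = 1 / (20 * b) by field_simp; ring]
          exact one_div_le_one_div_of_le (by norm_num) (by nlinarith)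
  have hPR : P.Regime L lam := by
    refine ⟨hL1, hlam1, ?_, hσeq, rfl, rfl, rfl, rfl, rfl, rfl, ?_, hγ₀1, ?_⟩
    · -- `λ_q ≤ L^{1/b₀}`
      rw [hLlam, ← Real.rpow_natCast lam b, ← Real.rpow_mul hlam0]
      calc lam = lam ^ (1 : ℝ) := (Real.rpow_one lam).symm
        _ ≤ lam ^ ((b : ℝ) * (1 / B0)) := Real.rpow_le_rpow_of_exponent_le hlam1 (by
            rw [JetStep.B0, mul_one_div, le_div_iff₀ (by norm_num)]; linarith)
    · -- `δ ≤ γ₀`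
      show lam ^ (-εR) * γ₀ ≤ γ₀
      exact mul_le_of_le_one_left hγ₀0.le (Real.rpow_le_one_of_one_le_of_nonpos hlam1 (by linarith))
    · -- `γ₀ ≥ L^{-1/(20 b₀)}`
      show L ^ (-(1 / (20 * B0))) ≤ amp β a b (q + 1)
      refine le_trans (Real.rpow_le_rpow_of_exponent_le hL1 ?_) (rpow_le_amp ha1 b hβ.le (q + 1))
      linarith
  -- the hypotheses of the step at level `q`
  obtain ⟨hv0, hv1, hvt⟩ := c1xtLE_sup_bounds S.c1v hT.le
  obtain ⟨v', p', R', hnsr', hmean', hinc, hl1', hsup', hc0', hc1', hct'⟩ :=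
    hstep P ν S.v S.p S.R hPV hν hν1 S.nsr S.mean hv0 hv1 hvt S.supR S.l1R
  obtain ⟨aInc, aL1, aSup, aC1⟩ := hL₀P hPV hPR rfl hL₀L
  -- the inductive bounds at level `q+1`
  have hL4 : L ^ (4 : ℝ) = (freq a b (q + 1) : ℝ) ^ 4 := by
    rw [show (4 : ℝ) = ((4 : ℕ) : ℝ) by norm_num, Real.rpow_natCast]
  have hL10 : L ^ (10 : ℝ) = (freq a b (q + 1) : ℝ) ^ 10 := by
    rw [show (10 : ℝ) = ((10 : ℕ) : ℝ) by norm_num, Real.rpow_natCast]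
  have hl1bound : L ^ (-(11 / 200 : ℝ)) ≤ (freq a b (q + 1) : ℝ) ^ (-εR) * amp β a b (q + 1 + 1) := by
    have h1 : L ^ (-(1 / 20 : ℝ)) ≤ amp β a b (q + 1 + 1) := by
      refine le_trans ?_ (rpow_le_amp ha1 b hβ.le (q + 1 + 1))
      rw [freq_succ_real a b (q + 1), ← hLdef, ← Real.rpow_natCast L b, ← Real.rpow_mul hL0.le]
      refine Real.rpow_le_rpow_of_exponent_le hL1 ?_
      nlinarith
    have h2 : L ^ (-(1 / 200 : ℝ)) ≤ L ^ (-εR) := Real.rpow_le_rpow_of_exponent_le hL1 (by linarith)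
    calc L ^ (-(11 / 200 : ℝ)) = L ^ (-(1 / 200 : ℝ)) * L ^ (-(1 / 20 : ℝ)) := by
          rw [← Real.rpow_add hL0]; norm_num
      _ ≤ L ^ (-εR) * amp β a b (q + 1 + 1) :=
          mul_le_mul h2 h1 (Real.rpow_nonneg hL0.le _) (Real.rpow_nonneg hL0.le _)
  refine ⟨⟨v', p', R', hnsr', hmean', ?_, ?_, ?_⟩, ?_⟩
  · -- (2.3) at level `q+1`
    refine c1xtLE_of_bounds (B₀ := P.stepC0 c) (B₁ := P.stepC1 c) (B₂ := P.stepCt c) hc0' (fun i t ht x => hc1' t ht x i)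
      hct' ?_
    rw [← hL4]; exact aC1
  · -- (2.4) at level `q+1`
    intro t ht
    exact (hl1' t ht).trans (aL1.trans hl1bound)
  · -- sup part of (2.5) at level `q+1`
    intro t ht x
    rw [← hL10]; exact (hsup' t ht x).trans aSup
  · -- (2.8)
    intro t ht
    refine (hinc t ht).trans (ENNReal.ofReal_le_ofReal (aInc.trans (le_of_eq ?_)))
    rw [Real.sqrt_eq_rpow]

/-! ## The iteration from level `n` and the limit of §2.4: the named fact, proved -/

set_option maxHeartbeats 1600000 in
/-- **Buckmaster–Vicol 2019, Prop. 2.1 iterated from level `n` with the limit of §2.4 — the named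
fact `BuckmasterVicol2019_iterationFromLevel`, proved.** Parameters: `b₀ = 20000`, `ε₀ = 1/200`,
`N_Λ = 1`, `K = M^{1-β'} 2^{β'}` with the absolute `M` of `jstage_step`, `a₀` the threshold of
`jstage_step` (and `≥ 2`). Given a triple at level `n ≥ 1` obeying (2.3)–(2.5), `jstage_step`
produces stages at all levels `n + k` with `‖v_{k+1} - v_k‖_{L²} ≤ M δ_{n+k+1}^{1/2}`; the limit
`w = lim v_k` (a.e. and in `L²`) is a weak Navier–Stokes solution (the defect
`∫∫ R̊ : ∇ψ ≤ C_ψ T λ^{-ε_R} δ → 0`), of zero mean, in `C⁰([0,T]; H^{β'})` with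
`‖w - v‖_{H^{β'}} ≤ ∑_k ‖v_{k+1} - v_k‖_{L²}^{1-β'} ‖v_{k+1} - v_k‖_{H¹}^{β'} ≤ K ∑_k δ_{n+k+1}^{(1-β')/2} λ_{n+k+1}^{4β'}`
(interpolation, (2.8), (2.3)), exactly as in the proof of `BuckmasterVicol2019_thm12_of_prop21`.
[cite: BuckmasterVicol2019Annals, Prop. 2.1, §2.4 (2.9)–(2.10), §2.5 (2.11)] -/
theorem BuckmasterVicol2019_iterationFromLevel_holds : BuckmasterVicol2019_iterationFromLevel := by
  refine ⟨20000, fun b hb hb16 β hβ _hβb2 hβb => ⟨1 / 200, by norm_num, fun εR hεR hεR0 => ⟨1, one_pos, ?_⟩⟩⟩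
  intro T hT β' hβ'0 hβ'
  obtain ⟨M, hM, hstepT⟩ := jstage_step hb hb16 hβ hβb hεR hεR0
  obtain ⟨a₀, hstep⟩ := hstepT hT
  have hb2 : 2 ≤ b := by omega
  have hb1 : 1 ≤ b := by omega
  have hβ4 : β' < β / 4 := by
    have h8 : β / (8 + β) ≤ β / 4 := div_le_div_of_nonneg_left hβ.le (by norm_num) (by linarith)
    linarith
  have hβ'1 : β' ≤ 1 := by
    have : β / (8 + β) < 1 := by rw [div_lt_one (by linarith)]; linarith
    linarith
  -- the decay exponent of the `H^{β'}` increments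
  set γ : ℝ := β * (1 - β') - 4 * β' with hγ
  have hγ0 : 0 < γ := by
    have h1 : β' * (8 + β) < β := by rwa [lt_div_iff₀ (by linarith)] at hβ'
    rw [hγ]; nlinarith
  set K : ℝ := M ^ (1 - β') * 2 ^ β' with hK
  have hK0 : 0 < K := by positivity
  refine ⟨K, hK0, max a₀ 2, fun a ha _hdvd ν hν hν1 n hn v p R hns hmean hc1v hl1R hc1R => ?_⟩
  have ha2 : 2 ≤ a := le_trans (le_max_right _ _) ha
  have ha1 : 1 ≤ a := le_trans one_le_two ha2
  have haR : (1 : ℝ) < a := by exact_mod_cast lt_of_lt_of_le one_lt_two ha2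
  have hstep' := fun q (hq : 1 ≤ q) (S : JStage ν T εR β a b q) => hstep (le_trans (le_max_left _ _) ha) hν hν1 q hq S
  -- Step 1: the initial stage at level `n` and the iteration
  obtain ⟨hRsup, -, -⟩ := c1xtLE_sup_bounds hc1R hT.le
  let S₀ : JStage ν T εR β a b n :=
    { v := v, p := p, R := R, nsr := hns, mean := hmean, c1v := hc1v, l1R := hl1R, supR := hRsup }
  have stepE : ∀ k (S : JStage ν T εR β a b (n + k)), ∃ S' : JStage ν T εR β a b (n + k + 1),
      ∀ t ∈ Icc 0 T, eLpNorm (S'.v t - S.v t) 2 volume ≤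
        ENNReal.ofReal (M * amp β a b (n + k + 1) ^ (1 / 2 : ℝ)) := fun k S => hstep' (n + k) (by omega) S
  choose stepF hstepF using stepE
  let S : ∀ k, JStage ν T εR β a b (n + k) := JStage.iterate S₀ stepF
  set vq : ℕ → ℝ → 𝕋³ → ℝ³ := fun k => (S k).v with hvq
  have hvq0 : vq 0 = v := rfl
  have hincr : ∀ k, ∀ t ∈ Icc 0 T, eLpNorm (vq (k + 1) t - vq k t) 2 volume ≤
      ENNReal.ofReal (M * amp β a b (n + k + 1) ^ (1 / 2 : ℝ)) := fun k t ht => hstepF k (S k) t ht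
  -- Step 2: regularity and bounds of the stages
  have hsm : ∀ k, Torus.IsSmoothSpaceTimeOn (Icc 0 T) (vq k) := fun k => (S k).nsr.smooth_velocity
  have hslice : ∀ k, ∀ t ∈ Icc 0 T, Torus.IsSmooth (vq k t) := fun k t ht => (hsm k).isSmooth_slice ht
  have hcont : ∀ k, ∀ t ∈ Icc 0 T, Continuous (vq k t) := fun k t ht => (hslice k t ht).continuous
  have hmeas_slice : ∀ k, ∀ t ∈ Icc 0 T, AEStronglyMeasurable (vq k t) volume := fun k t ht =>
    (hcont k t ht).aestronglyMeasurable
  have hint_c : ∀ k, ∀ t ∈ Icc 0 T, Integrable (EuclideanSpace.complexify ∘ vq k t) volume :=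
    fun k t ht => integrable_complexify_comp (hcont k t ht).integrable_unitAddTorus
  have hbounds : ∀ k, ∃ (B₀ : ℝ) (B₁ : Fin 3 → ℝ), 0 ≤ B₀ ∧ (∀ i, 0 ≤ B₁ i) ∧
      B₀ + ∑ i, B₁ i ≤ (freq a b (n + k) : ℝ) ^ 4 ∧ (∀ t ∈ Icc 0 T, ∀ x, ‖vq k t x‖ ≤ B₀) ∧
      ∀ i, ∀ t ∈ Icc 0 T, ∀ x, ‖Torus.partialDeriv i (vq k t) x‖ ≤ B₁ i := fun k =>
    c1xtLE_bounds (S k).c1v hT.le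
  choose B₀ B₁ hB₀0 hB₁0 hBsum hB₀ hB₁ using hbounds
  -- Step 3: the increments are summable in `L²` and in `H^{β'}`
  set L1r : ℝ := (freq a b 1 : ℝ) with hL1r
  have hL1r1 : 1 ≤ L1r := one_le_freq_real ha1 b 1
  set ε : ℕ → ℝ≥0∞ := fun k => ENNReal.ofReal (M * amp β a b (n + k + 1) ^ (1 / 2 : ℝ)) with hε
  have hε_eq : ∀ k, ε k = ENNReal.ofReal ((M * L1r ^ (3 * β / 2)) * (freq a b (k + (n + 1)) : ℝ) ^ (-β)) :=
    fun k => by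
      simp only [hε]
      rw [amp_rpow_half, mul_assoc, show n + k + 1 = k + (n + 1) by omega]
  have hsumε : ∑' k, ε k ≠ ⊤ := by
    simp_rw [hε_eq]
    exact tsum_ofReal_mul_freq_rpow_neg_ne_top ha2 hb2 hβ _ (n + 1)
  set tailε : ℕ → ℝ≥0∞ := fun q => ∑' i, ε (q + i) with htailε_def
  have htailε_ne : ∀ q, tailε q ≠ ⊤ := fun q =>
    ne_top_of_le_ne_top hsumε (ENNReal.tsum_comp_le_tsum_of_injective (add_right_injective q) _)
  have htailε : Tendsto tailε atTop (𝓝 0) := by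
    refine (ENNReal.tendsto_sum_nat_add ε hsumε).congr fun q => ?_
    exact tsum_congr fun i => by rw [add_comm]
  set KH : ℝ := M ^ (1 - β') * 2 ^ β' * L1r ^ (3 * β / 2 * (1 - β')) with hKH
  set H : ℕ → ℝ≥0∞ := fun k => ENNReal.ofReal (KH * (freq a b (n + k + 1) : ℝ) ^ (-γ)) with hH
  have hsumH : ∑' k, H k ≠ ⊤ := by
    have e : H = fun k => ENNReal.ofReal (KH * (freq a b (k + (n + 1)) : ℝ) ^ (-γ)) := by
      funext k; simp only [hH]; rw [show n + k + 1 = k + (n + 1) by omega]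
    rw [e]
    exact tsum_ofReal_mul_freq_rpow_neg_ne_top ha2 hb2 hγ0 _ (n + 1)
  set tailH : ℕ → ℝ≥0∞ := fun q => ∑' i, H (q + i) with htailH_def
  have htailH : Tendsto tailH atTop (𝓝 0) := by
    refine (ENNReal.tendsto_sum_nat_add H hsumH).congr fun q => ?_
    exact tsum_congr fun i => by rw [add_comm]
  -- the complexified fields
  set cvq : ℕ → ℝ → 𝕋³ → EuclideanSpace ℂ (Fin 3) := fun k t => EuclideanSpace.complexify ∘ vq k t
    with hcvq
  have hHincr : ∀ k, ∀ t ∈ Icc 0 T, Torus.eSobolevNorm β' (cvq (k + 1) t - cvq k t) ≤ H k := by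
    intro k t ht
    have hdsm : Torus.IsSmooth (vq (k + 1) t - vq k t) := (hslice (k + 1) t ht).sub (hslice k t ht)
    have hcs : cvq (k + 1) t - cvq k t = EuclideanSpace.complexify ∘ (vq (k + 1) t - vq k t) := by
      rw [hcvq, complexify_comp_sub]
    rw [hcs]
    -- the `L²` factor
    have h0 : Torus.eSobolevNorm 0 (EuclideanSpace.complexify ∘ (vq (k + 1) t - vq k t)) ≤ ε k := by
      rw [Torus.eSobolevNorm_zero_eq_eLpNorm_holds
        (integrable_complexify_comp hdsm.continuous.integrable_unitAddTorus)]
      have h1 : eLpNorm (EuclideanSpace.complexify ∘ (vq (k + 1) t - vq k t)) 2 volume =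
          eLpNorm (vq (k + 1) t - vq k t) 2 volume :=
        eLpNorm_congr_norm_ae (Eventually.of_forall fun x => by
          simp only [Function.comp_apply, EuclideanSpace.norm_complexify])
      rw [h1]
      exact hincr k t ht
    -- the `H¹` factor
    have h1 : Torus.eSobolevNorm 1 (EuclideanSpace.complexify ∘ (vq (k + 1) t - vq k t)) ≤
        ENNReal.ofReal (2 * (freq a b (n + k + 1) : ℝ) ^ 4) := by
      refine (eSobolevNorm_one_complexify_le_of_bounds hdsm (B₀ := B₀ (k + 1) + B₀ k)
        (B₁ := fun i => B₁ (k + 1) i + B₁ k i) (fun x => ?_) (fun i x => ?_)).trans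
        (ENNReal.ofReal_le_ofReal ?_)
      · exact (norm_sub_le _ _).trans (add_le_add (hB₀ (k + 1) t ht x) (hB₀ k t ht x))
      · rw [partialDeriv_sub ((hslice (k + 1) t ht).isContDiff (by simp))
          ((hslice k t ht).isContDiff (by simp))]
        exact (norm_sub_le _ _).trans (add_le_add (hB₁ (k + 1) i t ht x) (hB₁ k i t ht x))
      · rw [Finset.sum_add_distrib]
        have hmono : (freq a b (n + k) : ℝ) ^ 4 ≤ (freq a b (n + k + 1) : ℝ) ^ 4 :=
          pow_le_pow_left₀ (Nat.cast_nonneg _) (freq_le_freq_succ ha1 hb1 (n + k)) 4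
        have h1 : B₀ (k + 1) + ∑ i, B₁ (k + 1) i ≤ (freq a b (n + k + 1) : ℝ) ^ 4 := hBsum (k + 1)
        linarith [hBsum k]
    calc Torus.eSobolevNorm β' (EuclideanSpace.complexify ∘ (vq (k + 1) t - vq k t))
        ≤ Torus.eSobolevNorm 0 (EuclideanSpace.complexify ∘ (vq (k + 1) t - vq k t)) ^ (1 - β') *
            Torus.eSobolevNorm 1 (EuclideanSpace.complexify ∘ (vq (k + 1) t - vq k t)) ^ β' :=
          eSobolevNorm_le_interpolate hβ'0.le hβ'1 _
      _ ≤ ε k ^ (1 - β') * ENNReal.ofReal (2 * (freq a b (n + k + 1) : ℝ) ^ 4) ^ β' :=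
          mul_le_mul' (ENNReal.rpow_le_rpow h0 (by linarith)) (ENNReal.rpow_le_rpow h1 hβ'0.le)
      _ = H k := by
          simp only [hε, hH]
          rw [increment_rpow_eq ha1 hM.le hβ'0.le hβ'1]
  -- Step 4: the limit field
  set wq : ℕ → ℝ → 𝕋³ → ℝ³ := fun k t x => vq k (projIcc 0 T hT.le t) x with hwq
  have hwq_eq : ∀ k, ∀ t ∈ Icc 0 T, wq k t = vq k t := fun k t ht => by
    funext x
    simp only [hwq, projIcc_of_mem hT.le ht]
  have hwq_cont : ∀ k, Continuous (uncurry (wq k)) := fun k =>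
    continuous_uncurry_clamp_of_continuousOn hT.le (hsm k).continuousOn_stLift
  have hwq_cont' : ∀ k t, Continuous (wq k t) := fun k t =>
    (hwq_cont k).comp (continuous_const.prodMk continuous_id)
  set w : ℝ → 𝕋³ → ℝ³ := fun t x => limUnder atTop (fun k => wq k t x) with hw
  have hw_sm : StronglyMeasurable (uncurry w) :=
    StronglyMeasurable.limUnder (l := atTop) (f := fun k z => uncurry (wq k) z)
      fun k => (hwq_cont k).stronglyMeasurable
  have hw_slice_sm : ∀ t, StronglyMeasurable (w t) := fun t =>
    StronglyMeasurable.limUnder (l := atTop) (f := fun k x => wq k t x)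
      fun k => (hwq_cont' k t).stronglyMeasurable
  have hw_meas : ∀ t, AEStronglyMeasurable (w t) volume := fun t => (hw_slice_sm t).aestronglyMeasurable
  -- `L²` tail bounds of the limit
  have hL2tail : ∀ q, ∀ t ∈ Icc 0 T, eLpNorm (w t - vq q t) 2 volume ≤ tailε q := by
    intro q t ht
    have h := eLpNorm_limUnder_sub_le_tsum (μ := (volume : Measure 𝕋³)) (w := fun k => wq k t)
      (ε := ε) (fun k => (hwq_cont' k t).aestronglyMeasurable)
      (fun k => by
        show eLpNorm (wq (k + 1) t - wq k t) 2 volume ≤ ε k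
        rw [hwq_eq _ t ht, hwq_eq _ t ht]
        exact hincr k t ht) hsumε q
    have hfun : (fun x => limUnder atTop (fun k => wq k t x) - wq q t x) = w t - vq q t := by
      funext x
      simp only [hw, Pi.sub_apply, hwq_eq q t ht]
    rw [hfun] at h
    exact h
  have hv0L2 : ∀ t ∈ Icc 0 T, eLpNorm (v t) 2 volume ≤ ENNReal.ofReal (B₀ 0) := fun t ht =>
    Torus.eLpNorm_le_of_forall_norm_le (fun x => hB₀ 0 t ht x) 2
  have hwL2 : ∀ t ∈ Icc 0 T, eLpNorm (w t) 2 volume ≤ tailε 0 + ENNReal.ofReal (B₀ 0) := fun t ht => by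
    have h := hL2tail 0 t ht
    calc eLpNorm (w t) 2 volume = eLpNorm ((w t - vq 0 t) + vq 0 t) 2 volume := by rw [sub_add_cancel]
      _ ≤ eLpNorm (w t - vq 0 t) 2 volume + eLpNorm (vq 0 t) 2 volume :=
          eLpNorm_add_le ((hw_meas t).sub (hmeas_slice 0 t ht)) (hmeas_slice 0 t ht) one_le_two
      _ ≤ tailε 0 + ENNReal.ofReal (B₀ 0) := add_le_add h (hv0L2 t ht)
  have hwL2top : tailε 0 + ENNReal.ofReal (B₀ 0) ≠ ⊤ := ENNReal.add_ne_top.2 ⟨htailε_ne 0, ENNReal.ofReal_ne_top⟩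
  have hwL2' : ∀ t ∈ Icc 0 T, eLpNorm (w t) 2 volume < ⊤ := fun t ht =>
    lt_of_le_of_lt (hwL2 t ht) (lt_top_iff_ne_top.2 hwL2top)
  have hw_memLp : ∀ t ∈ Icc 0 T, MemLp (w t) 2 volume := fun t ht => ⟨hw_meas t, hwL2' t ht⟩
  have hw_int : ∀ t ∈ Icc 0 T, Integrable (w t) volume := fun t ht =>
    (hw_memLp t ht).integrable one_le_two
  -- `L¹` convergence of the slices
  have hL1 : ∀ t ∈ Icc 0 T, Tendsto (fun k => ∫ x, ‖vq k t x - w t x‖) atTop (𝓝 0) := by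
    intro t ht
    have hbd : ∀ k, ∫ x, ‖vq k t x - w t x‖ ≤ (tailε k).toReal := fun k => by
      have h1 : ∫ x, ‖vq k t x - w t x‖ = ∫ x, ‖(w t - vq k t) x‖ :=
        integral_congr_ae (ae_of_all _ fun x => by simp [norm_sub_rev])
      rw [h1]
      exact (integral_norm_le_toReal_eLpNorm_two ((hw_meas t).sub (hmeas_slice k t ht))
        (ne_top_of_le_ne_top (htailε_ne k) (hL2tail k t ht))).trans
        (ENNReal.toReal_mono (htailε_ne k) (hL2tail k t ht))
    refine squeeze_zero (fun k => integral_nonneg fun x => norm_nonneg _) hbd ?_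
    have h := (ENNReal.tendsto_toReal ENNReal.zero_ne_top).comp htailε
    rwa [ENNReal.toReal_zero] at h
  -- Step 5: the four properties of the limit
  refine ⟨w, ?_, ?_, ?_, ?_⟩
  · ---------------------------------------------------------------- weak solution
    refine isWeakNSSolutionOn_of_tendsto_L2_of_defect (useq := vq) (fun m => ?_) (fun m => ?_)
      (fun m => ?_) (fun ψ hψ hdiv => ?_) ?_ ?_ ?_
    · exact (hsm m).aestronglyMeasurable_stLift measurableSet_Ioo Ioo_subset_Icc_self
    · have hbd : ∀ t ∈ Ioo 0 T, ∫⁻ x, ‖vq m t x‖ₑ ^ 2 ≤ ENNReal.ofReal (B₀ m) ^ 2 := fun t ht => by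
        calc ∫⁻ x, ‖vq m t x‖ₑ ^ 2 ≤ ∫⁻ _ : 𝕋³, ENNReal.ofReal (B₀ m) ^ 2 :=
              lintegral_mono fun x => by
                rw [← ofReal_norm]
                exact pow_le_pow_left' (ENNReal.ofReal_le_ofReal (hB₀ m t (Ioo_subset_Icc_self ht) x)) 2
          _ = ENNReal.ofReal (B₀ m) ^ 2 := by simp
      calc ∫⁻ t in Ioo 0 T, ∫⁻ x, ‖vq m t x‖ₑ ^ 2 ≤ ∫⁻ _ in Ioo 0 T, ENNReal.ofReal (B₀ m) ^ 2 :=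
            setLIntegral_mono' measurableSet_Ioo hbd
        _ < ⊤ := by
            rw [setLIntegral_const]
            exact ENNReal.mul_lt_top (ENNReal.pow_lt_top ENNReal.ofReal_lt_top) measure_Ioo_lt_top
    · filter_upwards [ae_restrict_mem measurableSet_Ioo] with t ht
      exact Torus.IsDivFree.isWeaklyDivFree_holds (hslice m t (Ioo_subset_Icc_self ht))
        ((S m).nsr.divFree t (Ioo_subset_Icc_self ht))
    · -- the defect: `∫∫ ∑ⱼ ⟪R̊_m^{(j)}, ∂ⱼψ⟫ → 0`
      obtain ⟨Cψ, hCψ0, hCψ⟩ := hψ.isSpaceTimeTest.exists_bound_sum_partialDeriv isCompact_Icc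
        (K := Icc 0 T)
      have hid : ∀ m, (∫ t in Ioo 0 T, ∫ x, (⟪vq m t x, Torus.timeDeriv ψ t x⟫_ℝ +
          ⟪vq m t x, Torus.convect (vq m t) (ψ t) x⟫_ℝ + ν * ⟪vq m t x, Torus.laplacian (ψ t) x⟫_ℝ)) =
          ∫ t in Ioo 0 T, ∫ x, ∑ j, ⟪(S m).R t x j, Torus.partialDeriv j (ψ t) x⟫_ℝ := fun m => by
        have h := (S m).nsr.weak_identity subset_rfl hT hψ.isSpaceTimeTest hdiv
        rw [hψ.apply_zero] at h
        simpa using h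
      have hRb : ∀ m, ‖∫ t in Ioo 0 T, ∫ x, ∑ j, ⟪(S m).R t x j, Torus.partialDeriv j (ψ t) x⟫_ℝ‖ ≤
          (Cψ * ((freq a b (n + m) : ℝ) ^ (-εR) * amp β a b (n + m + 1))) * (volume (Ioo (0 : ℝ) T)).toReal :=
        fun m => by
        refine norm_setIntegral_le_of_norm_le_const measure_Ioo_lt_top (fun t ht => ?_)
        have htI : t ∈ Icc 0 T := Ioo_subset_Icc_self ht
        have hRsm : Torus.IsSmooth ((S m).R t) := (S m).nsr.smooth_stress.isSmooth_slice htI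
        have hpt : ∀ x, ‖∑ j, ⟪(S m).R t x j, Torus.partialDeriv j (ψ t) x⟫_ℝ‖ ≤ Cψ * ‖(S m).R t x‖ :=
          fun x => by
          calc ‖∑ j, ⟪(S m).R t x j, Torus.partialDeriv j (ψ t) x⟫_ℝ‖
              ≤ ∑ j, ‖⟪(S m).R t x j, Torus.partialDeriv j (ψ t) x⟫_ℝ‖ := norm_sum_le _ _
            _ ≤ ∑ j, ‖(S m).R t x‖ * ‖Torus.partialDeriv j (ψ t) x‖ :=
                Finset.sum_le_sum fun j _ => (norm_inner_le_norm _ _).trans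
                  (mul_le_mul_of_nonneg_right (norm_le_pi_norm ((S m).R t x) j) (norm_nonneg _))
            _ = ‖(S m).R t x‖ * ∑ j, ‖Torus.partialDeriv j (ψ t) x‖ := (Finset.mul_sum _ _ _).symm
            _ ≤ ‖(S m).R t x‖ * Cψ := mul_le_mul_of_nonneg_left (hCψ t htI x) (norm_nonneg _)
            _ = Cψ * ‖(S m).R t x‖ := mul_comm _ _
        calc ‖∫ x, ∑ j, ⟪(S m).R t x j, Torus.partialDeriv j (ψ t) x⟫_ℝ‖
            ≤ ∫ x, Cψ * ‖(S m).R t x‖ :=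
              norm_integral_le_of_norm_le ((hRsm.continuous.norm).integrable_unitAddTorus.const_mul Cψ)
                (ae_of_all _ hpt)
          _ = Cψ * ∫ x, ‖(S m).R t x‖ := integral_const_mul _ _
          _ ≤ Cψ * ((freq a b (n + m) : ℝ) ^ (-εR) * amp β a b (n + m + 1)) :=
              mul_le_mul_of_nonneg_left ((S m).l1R t htI) hCψ0
      -- the bound tends to zero
      have hgeo : Tendsto (fun m : ℕ => ((a : ℝ) ^ (-εR)) ^ m) atTop (𝓝 0) :=
        tendsto_pow_atTop_nhds_zero_of_lt_one (Real.rpow_nonneg (Nat.cast_nonneg _) _)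
          (Real.rpow_lt_one_of_one_lt_of_neg haR (by linarith))
      have hr0 : 0 ≤ (a : ℝ) ^ (-εR) := Real.rpow_nonneg (Nat.cast_nonneg _) _
      have hr1 : (a : ℝ) ^ (-εR) ≤ 1 := Real.rpow_le_one_of_one_le_of_nonpos haR.le (by linarith)
      have hdom : ∀ m, (freq a b (n + m) : ℝ) ^ (-εR) * amp β a b (n + m + 1) ≤
          ((a : ℝ) ^ (-εR)) ^ m * L1r ^ (3 * β) := fun m => by
        have hamp : amp β a b (n + m + 1) ≤ L1r ^ (3 * β) := by
          rw [amp]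
          refine mul_le_of_le_one_right (Real.rpow_nonneg (Nat.cast_nonneg _) _) ?_
          exact Real.rpow_le_one_of_one_le_of_nonpos (one_le_freq_real ha1 b _) (by linarith)
        have hf : (freq a b (n + m) : ℝ) ^ (-εR) ≤ ((a : ℝ) ^ (-εR)) ^ m :=
          (freq_rpow_neg_le_pow ha1 hb2 hεR.le (n + m)).trans (pow_le_pow_of_le_one hr0 hr1 (by omega))
        exact mul_le_mul hf hamp (amp_pos β ha1 b _).le (pow_nonneg hr0 m)
      have hbound0 : Tendsto (fun m => (Cψ * (((a : ℝ) ^ (-εR)) ^ m * L1r ^ (3 * β))) *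
          (volume (Ioo (0 : ℝ) T)).toReal) atTop (𝓝 0) := by
        have h := ((hgeo.mul_const (L1r ^ (3 * β))).const_mul Cψ).mul_const
          (volume (Ioo (0 : ℝ) T)).toReal
        simpa using h
      rw [show (fun m => ∫ t in Ioo 0 T, ∫ x, (⟪vq m t x, Torus.timeDeriv ψ t x⟫_ℝ +
          ⟪vq m t x, Torus.convect (vq m t) (ψ t) x⟫_ℝ + ν * ⟪vq m t x, Torus.laplacian (ψ t) x⟫_ℝ)) =
          fun m => ∫ t in Ioo 0 T, ∫ x, ∑ j, ⟪(S m).R t x j, Torus.partialDeriv j (ψ t) x⟫_ℝ from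
        funext hid]
      refine squeeze_zero_norm (fun m => (hRb m).trans ?_) hbound0
      exact mul_le_mul_of_nonneg_right (mul_le_mul_of_nonneg_left (hdom m) hCψ0) ENNReal.toReal_nonneg
    · exact Torus.aestronglyMeasurable_stLift_of_uncurry (S := Ioo 0 T) hw_sm.aestronglyMeasurable
    · calc ∫⁻ t in Ioo 0 T, ∫⁻ x, ‖w t x‖ₑ ^ 2 ≤ ∫⁻ _ in Ioo 0 T, (tailε 0 + ENNReal.ofReal (B₀ 0)) ^ 2 :=
            setLIntegral_mono' measurableSet_Ioo fun t ht => by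
              rw [← eLpNorm_two_sq_eq_lintegral]
              exact pow_le_pow_left' (hwL2 t (Ioo_subset_Icc_self ht)) 2
        _ < ⊤ := by
            rw [setLIntegral_const]
            exact ENNReal.mul_lt_top (ENNReal.pow_lt_top (lt_top_iff_ne_top.2 hwL2top)) measure_Ioo_lt_top
    · have hbd : ∀ m, ∫⁻ t in Ioo 0 T, ∫⁻ x, ‖vq m t x - w t x‖ₑ ^ 2 ≤
          volume (Ioo (0 : ℝ) T) * tailε m ^ 2 := fun m => by
        calc ∫⁻ t in Ioo 0 T, ∫⁻ x, ‖vq m t x - w t x‖ₑ ^ 2 ≤ ∫⁻ _ in Ioo 0 T, tailε m ^ 2 :=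
              setLIntegral_mono' measurableSet_Ioo fun t ht => by
                change ∫⁻ x, ‖(vq m t - w t) x‖ₑ ^ 2 ≤ _
                rw [← eLpNorm_two_sq_eq_lintegral, eLpNorm_sub_comm]
                exact pow_le_pow_left' (hL2tail m t (Ioo_subset_Icc_self ht)) 2
          _ = volume (Ioo (0 : ℝ) T) * tailε m ^ 2 := by rw [setLIntegral_const, mul_comm]
      have h0 : Tendsto (fun m => volume (Ioo (0 : ℝ) T) * tailε m ^ 2) atTop (𝓝 0) := by
        have h := ENNReal.Tendsto.const_mul (ENNReal.Tendsto.pow (n := 2) htailε)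
          (Or.inr measure_Ioo_lt_top.ne) (a := volume (Ioo (0 : ℝ) T))
        simpa using h
      exact tendsto_of_tendsto_of_tendsto_of_le_of_le tendsto_const_nhds h0 (fun _ => zero_le) hbd
  · ---------------------------------------------------------------- zero mean
    intro t ht
    have hlim : Tendsto (fun k => ∫ x, vq k t x) atTop (𝓝 (∫ x, w t x)) := by
      refine tendsto_integral_of_L1 _ (hw_meas t)
        (Eventually.of_forall fun k => (hcont k t ht).integrable_unitAddTorus) ?_
      refine tendsto_of_tendsto_of_tendsto_of_le_of_le tendsto_const_nhds htailε
        (fun k => zero_le) (fun k => ?_)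
      calc ∫⁻ x, ‖vq k t x - w t x‖ₑ = eLpNorm (vq k t - w t) 1 volume := by
            rw [eLpNorm_one_eq_lintegral_enorm]; rfl
        _ ≤ eLpNorm (vq k t - w t) 2 volume := by
            simpa using eLpNorm_le_eLpNorm_mul_rpow_measure_univ (p := 1) (q := 2)
              (μ := (volume : Measure 𝕋³)) (by norm_num)
              ((hmeas_slice k t ht).sub (hw_meas t))
        _ = eLpNorm (w t - vq k t) 2 volume := eLpNorm_sub_comm _ _ _ _
        _ ≤ tailε k := hL2tail k t ht
    have hzero : ∀ k, ∫ x, vq k t x = 0 := fun k => (S k).mean t ht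
    simp only [hzero] at hlim
    exact tendsto_nhds_unique hlim tendsto_const_nhds
  · ---------------------------------------------------------------- `C⁰_t H^{β'}_x`
    set cw : ℝ → 𝕋³ → EuclideanSpace ℂ (Fin 3) := fun t => EuclideanSpace.complexify ∘ w t with hcw
    have hint_cw : ∀ t ∈ Icc 0 T, Integrable (cw t) volume := fun t ht =>
      integrable_complexify_comp (hw_int t ht)
    have hHtail : ∀ q, ∀ t ∈ Icc 0 T, Torus.eSobolevNorm β' (cw t - cvq q t) ≤ tailH q := by
      intro q t ht
      refine eSobolevNorm_le_of_tendsto (f := fun k => cvq (q + k) t - cvq q t) (g := cw t - cvq q t)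
        (fun k => (hint_c _ t ht).sub (hint_c _ t ht)) ((hint_cw t ht).sub (hint_c q t ht)) ?_
        (fun k => ?_)
      · have h1 : ∀ k, ∫ x, ‖(cvq (q + k) t - cvq q t) x - (cw t - cvq q t) x‖ =
            ∫ x, ‖vq (q + k) t x - w t x‖ := fun k =>
          integral_congr_ae (ae_of_all _ fun x => by simp [hcvq, hcw, ← map_sub])
        simp_rw [h1]
        exact (hL1 t ht).comp ((tendsto_add_atTop_nat q).congr fun k => add_comm k q)
      · calc Torus.eSobolevNorm β' (cvq (q + k) t - cvq q t) ≤ ∑ i ∈ Finset.range k, H (q + i) :=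
              eSobolevNorm_sub_le_sum_of_le (g := fun j => cvq j t) (fun j => hint_c j t ht)
                (fun j => hHincr j t ht) q k
          _ ≤ tailH q := ENNReal.sum_le_tsum _
    -- `H^{β'}` size of the (smooth) initial field
    have hv0H : ∀ t ∈ Icc 0 T, Torus.eSobolevNorm β' (cvq 0 t) < ⊤ := fun t ht => by
      calc Torus.eSobolevNorm β' (cvq 0 t) ≤ Torus.eSobolevNorm 1 (cvq 0 t) := Torus.eSobolevNorm_mono hβ'1 _
        _ ≤ ENNReal.ofReal (B₀ 0 + ∑ i, B₁ 0 i) :=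
            eSobolevNorm_one_complexify_le_of_bounds (hslice 0 t ht) (fun x => hB₀ 0 t ht x) (fun i x => hB₁ 0 i t ht x)
        _ < ⊤ := ENNReal.ofReal_lt_top
    have hmemS : ∀ t ∈ Icc 0 T, Torus.MemSobolev β' (cw t) := fun t ht => by
      refine ⟨hint_cw t ht, ?_⟩
      have i1 : Integrable (cw t - cvq 0 t) volume := (hint_cw t ht).sub (hint_c 0 t ht)
      calc Torus.eSobolevNorm β' (cw t) = Torus.eSobolevNorm β' ((cw t - cvq 0 t) + cvq 0 t) := by
            rw [sub_add_cancel]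
        _ ≤ Torus.eSobolevNorm β' (cw t - cvq 0 t) + Torus.eSobolevNorm β' (cvq 0 t) :=
            Torus.eSobolevNorm_add_le_holds i1 (hint_c 0 t ht)
        _ < ⊤ := by
            refine ENNReal.add_lt_top.2 ⟨lt_of_le_of_lt (hHtail 0 t ht) ?_, hv0H t ht⟩
            refine lt_top_iff_ne_top.2 (ne_top_of_le_ne_top hsumH ?_)
            exact ENNReal.tsum_comp_le_tsum_of_injective (add_right_injective 0) _
    refine ⟨hmemS, fun t₀ ht₀ => ?_⟩
    rw [ENNReal.tendsto_nhds_zero]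
    intro δ hδ
    have hδ3 : 0 < δ / 3 := ENNReal.div_pos hδ.ne' (by norm_num)
    obtain ⟨q, hq⟩ : ∃ q, tailH q ≤ δ / 3 := ((ENNReal.tendsto_nhds_zero.1 htailH) (δ / 3) hδ3).exists
    -- a real `η > 0` with `4η ≤ δ/3`
    obtain ⟨η, hη0, hη⟩ : ∃ η : ℝ, 0 < η ∧ ENNReal.ofReal (4 * η) ≤ δ / 3 := by
      obtain ⟨r, hr0, hr⟩ := exists_between hδ3
      have hrtop : r ≠ ⊤ := ne_top_of_lt hr
      refine ⟨r.toReal / 4, div_pos (ENNReal.toReal_pos hr0.ne' hrtop) four_pos, ?_⟩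
      rw [show 4 * (r.toReal / 4) = r.toReal by ring, ENNReal.ofReal_toReal hrtop]
      exact hr.le
    have hq_cont : ∀ᶠ s in 𝓝[Icc 0 T] t₀, Torus.eSobolevNorm β' (cvq q s - cvq q t₀) ≤ δ / 3 := by
      have e0 := (hsm q).eventually_norm_sub_lt ht₀ hη0
      have e1 : ∀ i, ∀ᶠ s in 𝓝[Icc 0 T] t₀, ∀ x,
          ‖Torus.partialDeriv i (vq q s) x - Torus.partialDeriv i (vq q t₀) x‖ < η := fun i =>
        ((hsm q).partialDeriv (uniqueDiffOn_Icc hT) i).eventually_norm_sub_lt ht₀ hη0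
      have e1' : ∀ᶠ s in 𝓝[Icc 0 T] t₀, ∀ i x,
          ‖Torus.partialDeriv i (vq q s) x - Torus.partialDeriv i (vq q t₀) x‖ < η :=
        eventually_all.2 e1
      filter_upwards [e0, e1', eventually_mem_nhdsWithin] with s hs0 hs1 hsI
      have hdsm : Torus.IsSmooth (vq q s - vq q t₀) := (hslice q s hsI).sub (hslice q t₀ ht₀)
      have hcs : cvq q s - cvq q t₀ = EuclideanSpace.complexify ∘ (vq q s - vq q t₀) := by
        rw [hcvq, complexify_comp_sub]
      rw [hcs]
      calc Torus.eSobolevNorm β' (EuclideanSpace.complexify ∘ (vq q s - vq q t₀))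
          ≤ Torus.eSobolevNorm 1 (EuclideanSpace.complexify ∘ (vq q s - vq q t₀)) :=
            Torus.eSobolevNorm_mono hβ'1 _
        _ ≤ ENNReal.ofReal (η + ∑ _i : Fin 3, η) :=
            eSobolevNorm_one_complexify_le_of_bounds hdsm (fun x => (hs0 x).le) (fun i x => by
              rw [partialDeriv_sub ((hslice q s hsI).isContDiff (by simp))
                ((hslice q t₀ ht₀).isContDiff (by simp))]
              exact (hs1 i x).le)
        _ = ENNReal.ofReal (4 * η) := by
            congr 1
            simp only [Finset.sum_const, Finset.card_univ, Fintype.card_fin]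
            ring
        _ ≤ δ / 3 := hη
    filter_upwards [hq_cont, eventually_mem_nhdsWithin] with t hqt htI
    have i1 : Integrable (cw t - cvq q t) volume := (hint_cw t htI).sub (hint_c q t htI)
    have i2 : Integrable (cvq q t - cvq q t₀) volume := (hint_c q t htI).sub (hint_c q t₀ ht₀)
    have i3 : Integrable (cvq q t₀ - cw t₀) volume := (hint_c q t₀ ht₀).sub (hint_cw t₀ ht₀)
    have hsplit : cw t - cw t₀ = ((cw t - cvq q t) + (cvq q t - cvq q t₀)) + (cvq q t₀ - cw t₀) := by
      abel
    have h3 : Torus.eSobolevNorm β' (cvq q t₀ - cw t₀) ≤ δ / 3 := by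
      rw [← neg_sub, Torus.eSobolevNorm_neg]
      exact (hHtail q t₀ ht₀).trans hq
    have h12 : Torus.eSobolevNorm β' ((cw t - cvq q t) + (cvq q t - cvq q t₀)) ≤
        Torus.eSobolevNorm β' (cw t - cvq q t) + Torus.eSobolevNorm β' (cvq q t - cvq q t₀) :=
      Torus.eSobolevNorm_add_le_holds i1 i2
    show Torus.eSobolevNorm β' (cw t - cw t₀) ≤ δ
    calc Torus.eSobolevNorm β' (cw t - cw t₀)
        = Torus.eSobolevNorm β' (((cw t - cvq q t) + (cvq q t - cvq q t₀)) + (cvq q t₀ - cw t₀)) :=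
          congrArg (Torus.eSobolevNorm β') hsplit
      _ ≤ Torus.eSobolevNorm β' ((cw t - cvq q t) + (cvq q t - cvq q t₀)) +
            Torus.eSobolevNorm β' (cvq q t₀ - cw t₀) :=
          Torus.eSobolevNorm_add_le_holds (i1.add i2) i3
      _ ≤ (Torus.eSobolevNorm β' (cw t - cvq q t) + Torus.eSobolevNorm β' (cvq q t - cvq q t₀)) +
            Torus.eSobolevNorm β' (cvq q t₀ - cw t₀) :=
          add_le_add h12 le_rfl
      _ ≤ (δ / 3 + δ / 3) + δ / 3 := add_le_add (add_le_add ((hHtail q t htI).trans hq) hqt) h3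
      _ = δ := ENNReal.add_thirds δ
  · ---------------------------------------------------------------- the `H^{β'}` distance to `v`
    intro t ht
    -- `‖w - v‖ ≤ ∑ H k` (the case `q = 0` of the tail bound, proved once more to stay self-contained)
    have hHt : Torus.eSobolevNorm β' (EuclideanSpace.complexify ∘ (w t - v t)) ≤ ∑' k, H k := by
      have hcs : EuclideanSpace.complexify ∘ (w t - v t) = (EuclideanSpace.complexify ∘ w t) - cvq 0 t := by
        rw [complexify_comp_sub]; rfl
      rw [hcs]
      refine eSobolevNorm_le_of_tendsto (f := fun k => cvq (0 + k) t - cvq 0 t)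
        (g := (EuclideanSpace.complexify ∘ w t) - cvq 0 t)
        (fun k => (hint_c _ t ht).sub (hint_c _ t ht))
        ((integrable_complexify_comp (hw_int t ht)).sub (hint_c 0 t ht)) ?_ (fun k => ?_)
      · have h1 : ∀ k, ∫ x, ‖(cvq (0 + k) t - cvq 0 t) x - ((EuclideanSpace.complexify ∘ w t) - cvq 0 t) x‖ =
            ∫ x, ‖vq (0 + k) t x - w t x‖ := fun k =>
          integral_congr_ae (ae_of_all _ fun x => by simp [hcvq, ← map_sub])
        simp_rw [h1]
        exact (hL1 t ht).comp ((tendsto_add_atTop_nat 0).congr fun k => add_comm k 0)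
      · calc Torus.eSobolevNorm β' (cvq (0 + k) t - cvq 0 t) ≤ ∑ i ∈ Finset.range k, H (0 + i) :=
              eSobolevNorm_sub_le_sum_of_le (g := fun j => cvq j t) (fun j => hint_c j t ht)
                (fun j => hHincr j t ht) 0 k
          _ ≤ ∑' i, H (0 + i) := ENNReal.sum_le_tsum _
          _ = ∑' i, H i := tsum_congr fun i => by rw [zero_add]
    refine hHt.trans (le_of_eq ?_)
    -- `∑ H k = K ∑ δ^{(1-β')/2} λ^{4β'}`
    rw [← ENNReal.tsum_mul_left]
    refine tsum_congr fun k => ?_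
    simp only [hH]
    rw [← ENNReal.ofReal_mul hK0.le]
    congr 1
    have hf : (0 : ℝ) < (freq a b (n + 1 + k) : ℝ) := freq_real_pos ha1 b _
    have h1 : (0 : ℝ) < L1r := by linarith
    rw [show n + k + 1 = n + 1 + k by omega, amp, Real.mul_rpow (Real.rpow_nonneg h1.le _) (Real.rpow_nonneg hf.le _),
      ← Real.rpow_mul h1.le, ← Real.rpow_mul hf.le, hKH, hK, hγ]
    rw [show -(β * (1 - β') - 4 * β') = -2 * β * ((1 - β') / 2) + 4 * β' by ring, Real.rpow_add hf,
      show 3 * β / 2 * (1 - β') = 3 * β * ((1 - β') / 2) by ring]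
    ring

/-! ## Thm. 1.3, proved -/

/-- **Buckmaster–Vicol 2019, Thm. 1.3 (= EMS Surv. Thm. 3.10), proved**: every zero-mean weak Euler
solution in `C^{β̄}_{t,x}` is a strong `C⁰_t L²` vanishing-viscosity limit of weak Navier–Stokes
solutions uniformly bounded in `C⁰_t H^{β}`. The named fact `BuckmasterVicol2019_thm13` of the
barrier file, discharged from the proved assembly `BuckmasterVicol2019_thm13_of_parts`, the proved
start `BuckmasterVicol2019_mollifiedEulerStart_holds` (§2.5 (2.12)–(2.15)) and the proved
iteration `BuckmasterVicol2019_iterationFromLevel_holds` (Prop. 2.1 from level `n` + §2.4).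
[cite: BuckmasterVicol2019Annals, Thm. 1.3; BuckmasterVicol2020, Thm. 3.10] -/
theorem BuckmasterVicol2019_thm13_holds : BuckmasterVicol2019_thm13 :=
  BuckmasterVicol2019_thm13_of_parts BuckmasterVicol2019_iterationFromLevel_holds
    BuckmasterVicol2019_mollifiedEulerStart_holds

end Literature.Barriers.AnomalousDissipation
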